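import Literature.IUT.LogVolume.TensorPacketOrbitSpan
import Literature.IUT.LogVolume.LatticeAutFactorwiseSpan
import HarnessLib

/-!
# The FACTORWISE (Ind2)-orbit of a region already generates `c · log_p(R_I^×)`
# (Weil, *Basic Number Theory* Ch. II §2 Th. 1; [IUTchIII] Thm. 3.11 (i) (Ind2); Dupuy–Hilado §4.9, §4.12)

Companion of `TensorPacketOrbitSpan.lean`. There the hull LOWER bound `c·log_p(R_I^×) ⊆ closure(⋃_{g ∈ Ind2} g·M)`
is proved for Dupuy–Hilado's (Ind2) group `indTwo = Aut_{ℚ_p}(V : log_p(R_I^×))` — ALL lattice automorphisms of the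
tensor lattice — via TRANSITIVITY on primitive vectors. [IUTchIII] Thm. 3.11 (i) (Ind2) lets "independent copies of
Ism act on each of the direct summands of the `j+1` factors": on the real summand `V = ⊗_{ℚ_p, i} k_i` this is the
FACTORWISE family `⊗_i g_i`, `g_i ∈ Aut_{ℚ_p}(k_i : log_p(R_i^×))` (the cell's `LogShells.Ind2` read through a `p`-adic
presentation, `PadicPresentation.congr_mem_indTwo`), a proper subgroup of `indTwo` that is NOT transitive on
primitive vectors. This file proves that the lower bound — hence the two-sided hull identity — holds for the
factorwise family as well, for EVERY region and with no hypothesis on its shape, from the lattice algebra of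
`LatticeAutFactorwiseSpan.lean` (`PadicModule.smul_basisLattice_subset_closure_factorwiseOrbit`: the `ℤ`-span of the
factorwise orbit of ONE vector of content `c` is `c·L_B`, because `span_ℤ{⊗_i g_i} ⊇ ⊗_i End_{ℤ_p}(L_{b_i})`):

* **`smul_logPacket_subset_closure_factorwiseOrbit`** (adapted bases of the factor shells make `log_p(R_I^×)` the tensor
  basis lattice, `packetOf_eq_boxLattice`), `…_subset_packetHull_factorwiseOrbit`,
  the upper bound `packetHull_factorwiseOrbit_subset` (`image_logPacket_congr`: factorwise families map
  `log_p(R_I^×)` onto itself), the two-sided **`packetHull_factorwiseOrbit_eq`** / `…_eq_zpow`, and the comparison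
  **`packetHull_factorwiseOrbit_eq_packetHull_orbit`**: for a region of content exactly `c` the factorwise orbit
  and the full `indTwo`-orbit have THE SAME hull `hull(c·log_p(R_I^×))`.

So, at one tensor packet, the printed factorwise reading of (Ind2) and Dupuy–Hilado's full lattice group give the
same hull for every bounded region containing a vector of its own content (e.g. the Θ-slot boxes
`ι_a(t)·(R_I)^∼`, whatever the shape of `(R_I)^∼ ⊇ R_I`). [cite: WeilBNT1967, Ch. II §2, Th. 1]
[cite: Mochizuki2012, IUTchIII Thm. 3.11 (i) (Ind2) p. 154] [cite: DupuyHilado2025, §4.9, §4.12]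
The disputed-corpus constructions ((Ind2), the hull) are the tree's typings [claim: Mochizuki2012, status: disputed];
nothing here takes a side on [IUTchIII] Cor. 3.12. PROOF-ONLY file: no new definitions, no named `Prop` facts.
-/


noncomputable section

open Set Module Function
open scoped Pointwise TensorProduct

namespace Literature.IUT.LogVolume

/-! ## Packet level: `V = ⊗_{ℚ_p} k_i`, `log_p(R_I^×)`, the factorwise (Ind2) -/

variable (p : ℕ) [Fact p.Prime]
variable {I : Type} [Fintype I] [DecidableEq I] [Nonempty I]
variable (k : I → Type) [∀ i, NontriviallyNormedField (k i)] [∀ i, NormedAlgebra ℚ_[p] (k i)]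
  [∀ i, IsUltrametricDist (k i)] [∀ i, ProperSpace (k i)]

omit [Fintype I] [DecidableEq I] [Nonempty I] [∀ i, IsUltrametricDist (k i)] [∀ i, ProperSpace (k i)] in
/-- **Factorwise families preserving the factor shells map `log_p(R_I^×)` onto itself**: for `ℚ_p`-linear `g_i` with
`g_i(log_p(R_i^×)) = log_p(R_i^×)`, `(⊗_i g_i)(log_p(R_I^×)) = log_p(R_I^×)` (generators `⊗ z_i` go to generators).
[cite: Mochizuki2012, IUTchIV Prop. 1.2 p. 10] [cite: DupuyHilado2025, §4.9] -/
theorem image_logPacket_congr (g : ∀ i, k i ≃ₗ[ℚ_[p]] k i) (hg : ∀ i, g i '' logUnits (k i) = logUnits (k i)) :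
    (PiTensorProduct.congr g : PacketAlgebra p k ≃ₗ[ℚ_[p]] PacketAlgebra p k) ''
        (logPacket p k : Set (PacketAlgebra p k)) = logPacket p k := by
  set S : Set (PacketAlgebra p k) :=
    {t | ∃ z : ∀ i, k i, (∀ i, z i ∈ logUnits (k i)) ∧ t = purePacket p k z} with hSdef
  set ψ : PacketAlgebra p k ≃ₗ[ℚ_[p]] PacketAlgebra p k := PiTensorProduct.congr g
  have hS : ψ '' S = S := by
    apply Set.Subset.antisymm
    · rintro _ ⟨_, ⟨z, hz, rfl⟩, rfl⟩
      refine ⟨fun i => g i (z i), fun i => ?_, ?_⟩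
      · rw [← hg i]; exact ⟨z i, hz i, rfl⟩
      · simp [ψ, purePacket, PiTensorProduct.congr_tprod]
    · rintro _ ⟨z, hz, rfl⟩
      have hz' : ∀ i, ∃ y, y ∈ logUnits (k i) ∧ g i y = z i := fun i => by
        have : z i ∈ g i '' logUnits (k i) := by rw [hg i]; exact hz i
        exact this
      choose y hy hgy using hz'
      refine ⟨purePacket p k y, ⟨y, hy, rfl⟩, ?_⟩
      simp [ψ, purePacket, PiTensorProduct.congr_tprod, hgy]
  have hmap : ψ '' (logPacket p k : Set (PacketAlgebra p k)) =
      ((logPacket p k).map ψ.toLinearMap.toAddMonoidHom : Set (PacketAlgebra p k)) :=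
    (AddSubgroup.coe_map _ _).symm
  rw [hmap]
  unfold logPacket
  rw [AddMonoidHom.map_closure]
  exact congrArg (fun U : Set (PacketAlgebra p k) => ((AddSubgroup.closure U : AddSubgroup (PacketAlgebra p k)) :
    Set (PacketAlgebra p k))) hS

omit [Fintype I] [DecidableEq I] [Nonempty I] [∀ i, IsUltrametricDist (k i)] [∀ i, ProperSpace (k i)] in
/-- … hence such a factorwise family lies in Dupuy–Hilado's (Ind2) group `indTwo`. [cite: DupuyHilado2025, §4.9] -/
theorem congr_mem_indTwo (g : ∀ i, k i ≃ₗ[ℚ_[p]] k i) (hg : ∀ i, g i '' logUnits (k i) = logUnits (k i)) :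
    (PiTensorProduct.congr g : PacketAlgebra p k ≃ₗ[ℚ_[p]] PacketAlgebra p k) ∈ indTwo p k :=
  mem_indTwo_of_image_eq p k (image_logPacket_congr p k g hg)

/-- **Hull lower bound for the FACTORWISE (Ind2), additive form.** If `M` contains a vector
`x ∈ c·log_p(R_I^×) ∖ (c·p)·log_p(R_I^×)`, then `c·log_p(R_I^×) ⊆ closure(⋃_g (⊗_i g_i)(M))`, the union over the
families `g_i ∈ Aut_{ℚ_p}(k_i : log_p(R_i^×))` of [IUTchIII] Thm. 3.11 (i) (Ind2) ("independent copies of Ism on each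
factor") — no transitivity needed: the `ℤ`-span of the factorwise maps is all of `End_{ℤ_p}`.
[cite: WeilBNT1967, Ch. II §2, Th. 1] [cite: Mochizuki2012, IUTchIII Thm. 3.11 (i) (Ind2) p. 154] -/
theorem smul_logPacket_subset_closure_factorwiseOrbit {M : Set (PacketAlgebra p k)} {x : PacketAlgebra p k}
    {c : ℚ_[p]} (hxM : x ∈ M) (hxc : x ∈ c • (logPacket p k : Set (PacketAlgebra p k)))
    (hxp : x ∉ (c * p) • (logPacket p k : Set (PacketAlgebra p k))) :
    c • (logPacket p k : Set (PacketAlgebra p k)) ⊆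
      AddSubgroup.closure (⋃ g ∈ {g : ∀ i, k i ≃ₗ[ℚ_[p]] k i | ∀ i, g i '' logUnits (k i) = logUnits (k i)},
        (PiTensorProduct.congr g : PacketAlgebra p k ≃ₗ[ℚ_[p]] PacketAlgebra p k) '' M) := by
  classical
  have hMo : ∀ i, IsOpen ((logUnitsAddSubgroup p (k i) : AddSubgroup (k i)) : Set (k i)) :=
    fun i ↦ isOpen_logUnits p (k i)
  have hMc : ∀ i, IsCompact ((logUnitsAddSubgroup p (k i) : AddSubgroup (k i)) : Set (k i)) :=
    fun i ↦ isCompact_logUnits p (k i)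
  choose n bZ b c₀ hn hb hM using fun i => exists_adaptedBasis p (logUnitsAddSubgroup p (k i)) (hMo i) (hMc i)
  let b' : ∀ i, Basis (Fin (n i)) ℚ_[p] (k i) := fun i => (b i).unitsSMul (c₀ i)
  have hΛ : ∀ i (y : k i), y ∈ logUnits (k i) ↔ y ∈ PadicModule.basisLattice p (b' i) := fun i y => by
    rw [← PadicModule.boxLattice_eq_basisLattice_unitsSMul, ← hM i y]
    rfl
  have hB : PadicModule.basisLattice p (Basis.piTensorProduct b') = logPacket p k := by
    have h1 : logPacket p k = PadicModule.boxLattice p (Basis.piTensorProduct b')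
        (fun κ => ∏ i, (1 : Fin (n i) → ℚ_[p]ˣ) (κ i)) := by
      rw [logPacket_eq_packetOf]
      refine packetOf_eq_boxLattice p k b' (fun i => 1) _ (fun i y => ?_)
      rw [PadicModule.boxLattice_one]
      exact hΛ i y
    have h2 : (fun κ : ∀ i, Fin (n i) => ∏ i, (1 : Fin (n i) → ℚ_[p]ˣ) (κ i)) = 1 := by
      funext κ
      simp
    rw [h1, h2, PadicModule.boxLattice_one]
  rw [← hB] at hxc hxp ⊢
  obtain ⟨x₀, hx₀, rfl⟩ := Set.mem_smul_set.mp hxc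
  have hprim : x₀ ∉ (p : ℚ_[p]) •
      (PadicModule.basisLattice p (Basis.piTensorProduct b') : Set (PacketAlgebra p k)) := by
    rintro ⟨y, hy, rfl⟩
    exact hxp (Set.mem_smul_set.mpr ⟨y, hy, mul_smul _ _ _⟩)
  obtain ⟨κ₀, hκ₀⟩ := (PadicModule.primitive_iff_not_mem_p_smul p (Basis.piTensorProduct b') hx₀).mpr hprim
  refine (PadicModule.smul_basisLattice_subset_closure_factorwiseOrbit p b' hκ₀ hxM).trans ?_
  refine AddSubgroup.closure_mono (Set.iUnion₂_subset fun g hg => ?_)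
  refine Set.subset_iUnion₂_of_subset g (fun i => ?_) subset_rfl
  have hset : (logUnits (k i) : Set (k i)) = (PadicModule.basisLattice p (b' i) : Set (k i)) := Set.ext (hΛ i)
  rw [hset]
  exact latticeAut.image_eq (hg i)

/-- **Hull lower bound for the factorwise (Ind2)**: under the same hypothesis `c·log_p(R_I^×) ⊆ hull(⋃_g (⊗ g_i)(M))`
(the hull is an `(R_I)^∼`-submodule containing the orbit). [cite: DupuyHilado2025, §4.12] [cite: WeilBNT1967, Ch. II §2, Th. 1] -/
theorem smul_logPacket_subset_packetHull_factorwiseOrbit {M : Set (PacketAlgebra p k)} {x : PacketAlgebra p k}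
    {c : ℚ_[p]} (hxM : x ∈ M) (hxc : x ∈ c • (logPacket p k : Set (PacketAlgebra p k)))
    (hxp : x ∉ (c * p) • (logPacket p k : Set (PacketAlgebra p k))) :
    c • (logPacket p k : Set (PacketAlgebra p k)) ⊆
      packetHull p k (⋃ g ∈ {g : ∀ i, k i ≃ₗ[ℚ_[p]] k i | ∀ i, g i '' logUnits (k i) = logUnits (k i)},
        (PiTensorProduct.congr g : PacketAlgebra p k ≃ₗ[ℚ_[p]] PacketAlgebra p k) '' M) := by
  set U : Set (PacketAlgebra p k) := ⋃ g ∈ {g : ∀ i, k i ≃ₗ[ℚ_[p]] k i | ∀ i, g i '' logUnits (k i) = logUnits (k i)},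
    (PiTensorProduct.congr g : PacketAlgebra p k ≃ₗ[ℚ_[p]] PacketAlgebra p k) '' M with hU
  refine (smul_logPacket_subset_closure_factorwiseOrbit p k hxM hxc hxp).trans ?_
  change ((AddSubgroup.closure U : AddSubgroup (PacketAlgebra p k)) : Set (PacketAlgebra p k)) ⊆
    ((packetSpan p k U).toAddSubgroup : Set (PacketAlgebra p k))
  exact (AddSubgroup.closure_le _).mpr (subset_packetHull p k U)

/-- … hence **`hull(c·log_p(R_I^×)) ⊆ hull(⋃_g (⊗ g_i)(M))`**. [cite: DupuyHilado2025, §4.12] -/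
theorem packetHull_smul_logPacket_subset_factorwiseOrbit {M : Set (PacketAlgebra p k)} {x : PacketAlgebra p k}
    {c : ℚ_[p]} (hxM : x ∈ M) (hxc : x ∈ c • (logPacket p k : Set (PacketAlgebra p k)))
    (hxp : x ∉ (c * p) • (logPacket p k : Set (PacketAlgebra p k))) :
    packetHull p k (c • (logPacket p k : Set (PacketAlgebra p k))) ⊆
      packetHull p k (⋃ g ∈ {g : ∀ i, k i ≃ₗ[ℚ_[p]] k i | ∀ i, g i '' logUnits (k i) = logUnits (k i)},
        (PiTensorProduct.congr g : PacketAlgebra p k ≃ₗ[ℚ_[p]] PacketAlgebra p k) '' M) := by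
  rw [← packetHull_packetHull p k (⋃ g ∈ {g : ∀ i, k i ≃ₗ[ℚ_[p]] k i | ∀ i, g i '' logUnits (k i) = logUnits (k i)},
    (PiTensorProduct.congr g : PacketAlgebra p k ≃ₗ[ℚ_[p]] PacketAlgebra p k) '' M)]
  exact packetHull_mono p k (smul_logPacket_subset_packetHull_factorwiseOrbit p k hxM hxc hxp)

omit [Fintype I] [DecidableEq I] [Nonempty I] [∀ i, IsUltrametricDist (k i)] [∀ i, ProperSpace (k i)] in
/-- **Upper bound**: a factorwise family maps `c·log_p(R_I^×)` onto itself, so for `M ⊆ c·log_p(R_I^×)` the hull of the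
factorwise orbit lies in `hull(c·log_p(R_I^×))`. [cite: DupuyHilado2025, §4.9, §4.12] -/
theorem packetHull_factorwiseOrbit_subset {M : Set (PacketAlgebra p k)} {c : ℚ_[p]}
    (hM : M ⊆ c • (logPacket p k : Set (PacketAlgebra p k))) :
    packetHull p k (⋃ g ∈ {g : ∀ i, k i ≃ₗ[ℚ_[p]] k i | ∀ i, g i '' logUnits (k i) = logUnits (k i)},
        (PiTensorProduct.congr g : PacketAlgebra p k ≃ₗ[ℚ_[p]] PacketAlgebra p k) '' M) ⊆
      packetHull p k (c • (logPacket p k : Set (PacketAlgebra p k))) := by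
  refine packetHull_mono p k (Set.iUnion₂_subset fun g hg => ?_)
  refine (Set.image_mono hM).trans ?_
  rw [image_const_smul, image_logPacket_congr p k g hg]

/-- **Two-sided form for the factorwise (Ind2)**: for a region `M ⊆ c·log_p(R_I^×)` containing a vector of content
exactly `c`, `hull(⋃_g (⊗ g_i)(M)) = hull(c·log_p(R_I^×))`. [cite: WeilBNT1967, Ch. II §2, Th. 1] [cite: DupuyHilado2025, §4.9, §4.12] -/
theorem packetHull_factorwiseOrbit_eq {M : Set (PacketAlgebra p k)} {x : PacketAlgebra p k} {c : ℚ_[p]}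
    (hxM : x ∈ M) (hxp : x ∉ (c * p) • (logPacket p k : Set (PacketAlgebra p k)))
    (hM : M ⊆ c • (logPacket p k : Set (PacketAlgebra p k))) :
    packetHull p k (⋃ g ∈ {g : ∀ i, k i ≃ₗ[ℚ_[p]] k i | ∀ i, g i '' logUnits (k i) = logUnits (k i)},
        (PiTensorProduct.congr g : PacketAlgebra p k ≃ₗ[ℚ_[p]] PacketAlgebra p k) '' M) =
      packetHull p k (c • (logPacket p k : Set (PacketAlgebra p k))) :=
  Set.Subset.antisymm (packetHull_factorwiseOrbit_subset p k hM)
    (packetHull_smul_logPacket_subset_factorwiseOrbit p k hxM (hM hxM) hxp)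

/-- **The `p^m` form**: for `M ⊆ p^m·log_p(R_I^×)` containing a vector outside `p^{m+1}·log_p(R_I^×)`,
`hull(⋃_g (⊗ g_i)(M)) = hull(p^m·log_p(R_I^×))`. [cite: WeilBNT1967, Ch. II §2, Th. 2] [cite: DupuyHilado2025, §4.9, §4.12] -/
theorem packetHull_factorwiseOrbit_eq_zpow {M : Set (PacketAlgebra p k)} {x : PacketAlgebra p k} {m : ℤ}
    (hxM : x ∈ M) (hx' : x ∉ ((p : ℚ_[p]) ^ (m + 1)) • (logPacket p k : Set (PacketAlgebra p k)))
    (hM : M ⊆ ((p : ℚ_[p]) ^ m) • (logPacket p k : Set (PacketAlgebra p k))) :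
    packetHull p k (⋃ g ∈ {g : ∀ i, k i ≃ₗ[ℚ_[p]] k i | ∀ i, g i '' logUnits (k i) = logUnits (k i)},
        (PiTensorProduct.congr g : PacketAlgebra p k ≃ₗ[ℚ_[p]] PacketAlgebra p k) '' M) =
      packetHull p k (((p : ℚ_[p]) ^ m) • (logPacket p k : Set (PacketAlgebra p k))) :=
  packetHull_factorwiseOrbit_eq p k hxM (zpow_content p k (hM hxM) hx').2 hM

/-- **PRINT'S FACTORWISE (Ind2) AND DUPUY–HILADO'S FULL LATTICE GROUP GIVE THE SAME HULL**: for a region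
`M ⊆ c·log_p(R_I^×)` containing a vector of content exactly `c`, the hull of its factorwise orbit equals the hull of
its `indTwo`-orbit (both are `hull(c·log_p(R_I^×))`, `packetHull_orbit_eq`).
[cite: Mochizuki2012, IUTchIII Thm. 3.11 (i) (Ind2) p. 154] [cite: DupuyHilado2025, §4.9, §4.12] -/
theorem packetHull_factorwiseOrbit_eq_packetHull_orbit {M : Set (PacketAlgebra p k)} {x : PacketAlgebra p k}
    {c : ℚ_[p]} (hxM : x ∈ M) (hxp : x ∉ (c * p) • (logPacket p k : Set (PacketAlgebra p k)))
    (hM : M ⊆ c • (logPacket p k : Set (PacketAlgebra p k))) :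
    packetHull p k (⋃ g ∈ {g : ∀ i, k i ≃ₗ[ℚ_[p]] k i | ∀ i, g i '' logUnits (k i) = logUnits (k i)},
        (PiTensorProduct.congr g : PacketAlgebra p k ≃ₗ[ℚ_[p]] PacketAlgebra p k) '' M) =
      packetHull p k (⋃ g : indTwo p k, g • M) := by
  rw [packetHull_factorwiseOrbit_eq p k hxM hxp hM, packetHull_orbit_eq p k hxM hxp hM]

end Literature.IUT.LogVolume

end
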